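import Mathlib
import HarnessLib
import Summits.HubbardSuperconductivity.HubbardSuperconductivity.Theorems.KLProgrammeH10TwoPointLimitSymbolLineDerivTwo
import Literature.MathematicalPhysics.QuantumLattice.AngularCutoffLineBounds
import Literature.MathematicalPhysics.QuantumLattice.SectorProductSymbolDecay
import Literature.MathematicalPhysics.QuantumLattice.ScaleCutoffs

/-!
# Route `KLProgramme` — engine support, route (L2) symbol layer: the ANGULAR FACTOR of the two-multiplier symbol — plateaued two-sector
# angular profile times a smooth square cutoff — smooth on all of `ℝ²`, bounded by `1`, supported in the sector, vanishing beyond the zone,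
# with FIRST and SECOND line derivatives `O(2ⁿ‖w‖)`, `O(4ⁿ‖w‖²)` on the Fermi region of the square (uniformly in the base angle)

Cell `gate-hubbard-kl`, seat p4 (C5a lead), g6; HOME/prover-p4/FRAME-L22-NOTE.md §3″ (d).  The factor `Z` of the continuum symbol
`G(k₀² + e²)·Z` used for the pair `(ζ̃_{n₁,ω₁}, ζ̃_{n₂,ω₂})` of smooth angular sectors (`klAnisoFamily` at two scales):
`Z(p) = χ_sq(p₀²)χ_sq(p₁²) · [R(p)ζ̃_{n₁,ω₁}(θ(p))] · [R(p)ζ̃_{n₂,ω₂}(θ(p))]`, `R = radialCutoffC ½` (`≡ 1` for `‖p‖ ≥ ½`, makes the angular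
factors smooth through the origin, `contDiff_radial_mul_sectorWeightCirc_polarAngle`), `χ_sq = gnCutoff ((π+z)²/π²) ((π+z)²)` (`= 1` for
`t ≤ π²`, `= 0` for `t ≥ (π+z)²`: the symbol vanishes beyond the zone, as a sampled PERIODIC symbol must).  Proved here, for `Z` given by
this formula (hypothesis `hZ`):
* `contDiff_angularFactor`, `abs_angularFactor_le_one`, `angularFactor_support` (`Z p ≠ 0 ⇒` both `ζ̃ ≠ 0`), `angularFactor_zone`
  (`|p_j| ≥ π + z ⇒ Z p = 0`), `angularFactor_eventuallyEq` (near a point of the open square with `‖p‖ > ½` the cutoffs are `≡ 1`);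
* **`abs_derivs_angularFactor_line_le`** — at a point `p₀ + s•w` of the open square with `‖·‖ ≥ 1`:
  `|∂ₛZ| ≤ 2B(D₁ + D₂)`, `|∂ₛ²Z| ≤ 2B(D₁² + D₂²) + 8B²D₁D₂`, `Dᵢ = (1 + 2/w_{nᵢ})‖w₁ + iw₂‖` (`B` the constant of
  `exists_norm_iteratedDeriv_sectorWeightCirc_polarAngle_line_le 2`, base angle := the polar angle of the point itself).
Everything is proved; no definitions, no named facts. [folklore] (BGM 2006 §2.5 (2.45)–(2.46), §2.7 (2.71a).)
-/

noncomputable section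

namespace Summit.HubbardSuperconductivity.HubbardSuperconductivity.Theorems.TorusFourierL2

set_option linter.dupNamespace false -- summit = problem name (single-conjunct summit), D-0017

open Set Filter Topology Complex Literature.MathematicalPhysics.QuantumLattice Literature.Analysis.SpecialFunctions
open scoped Real Nat

/-! ### §1 The square cutoff -/

/-- The square-cutoff ratio is `> 1` and the outer level positive (`z > 0`). [folklore] -/
theorem sqCutoff_params {z : ℝ} (hz : 0 < z) : 1 < (π + z) ^ 2 / π ^ 2 ∧ 0 < (π + z) ^ 2 ∧ (π + z) ^ 2 / ((π + z) ^ 2 / π ^ 2) = π ^ 2 := by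
  have hπ := Real.pi_pos
  refine ⟨?_, by positivity, ?_⟩
  · rw [lt_div_iff₀ (by positivity), one_mul]
    nlinarith
  · field_simp

/-- `χ_sq(t) = 1` for `t ≤ π²`. [folklore] -/
theorem sqCutoff_eq_one {z t : ℝ} (hz : 0 < z) (ht : t ≤ π ^ 2) : gnCutoff ((π + z) ^ 2 / π ^ 2) ((π + z) ^ 2) t = 1 := by
  obtain ⟨h1, h2, h3⟩ := sqCutoff_params hz
  exact gnCutoff_eq_one h1 h2 (by rw [h3]; exact ht)

/-- `χ_sq(t) = 0` for `t ≥ (π + z)²`. [folklore] -/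
theorem sqCutoff_eq_zero {z t : ℝ} (hz : 0 < z) (ht : (π + z) ^ 2 ≤ t) : gnCutoff ((π + z) ^ 2 / π ^ 2) ((π + z) ^ 2) t = 0 := by
  obtain ⟨h1, h2, -⟩ := sqCutoff_params hz
  exact gnCutoff_eq_zero h1 h2 ht

/-! ### §2 The angular factor: smoothness, size, support, zone -/

section Angular

variable {z : ℝ} {n₁ n₂ : ℕ} {ω₁ ω₂ : ℤ} {Z : (Fin 2 → ℝ) → ℝ}
  (hZ : ∀ p, Z p = gnCutoff ((π + z) ^ 2 / π ^ 2) ((π + z) ^ 2) (p 0 ^ 2) * gnCutoff ((π + z) ^ 2 / π ^ 2) ((π + z) ^ 2) (p 1 ^ 2) *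
    ((radialCutoffC (1 / 2) (momToComplex p) * sectorWeightCirc n₁ ω₁ (polarAngle p)) *
      (radialCutoffC (1 / 2) (momToComplex p) * sectorWeightCirc n₂ ω₂ (polarAngle p))))
include hZ

/-- **The angular factor is smooth on all of `ℝ²`.** [folklore] -/
theorem contDiff_angularFactor {m : ℕ∞} : ContDiff ℝ m Z := by
  have hfun : Z = fun p => gnCutoff ((π + z) ^ 2 / π ^ 2) ((π + z) ^ 2) (p 0 ^ 2) * gnCutoff ((π + z) ^ 2 / π ^ 2) ((π + z) ^ 2) (p 1 ^ 2) *
      ((radialCutoffC (1 / 2) (momToComplex p) * sectorWeightCirc n₁ ω₁ (polarAngle p)) *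
        (radialCutoffC (1 / 2) (momToComplex p) * sectorWeightCirc n₂ ω₂ (polarAngle p))) := funext hZ
  rw [hfun]
  have hb : ∀ j : Fin 2, ContDiff ℝ m fun p : Fin 2 → ℝ => gnCutoff ((π + z) ^ 2 / π ^ 2) ((π + z) ^ 2) (p j ^ 2) := fun j =>
    (contDiff_gnCutoff _ _).comp ((contDiff_apply ℝ ℝ j).pow 2)
  exact ((hb 0).mul (hb 1)).mul ((contDiff_radial_mul_sectorWeightCirc_polarAngle (by norm_num) n₁ ω₁).mul
    (contDiff_radial_mul_sectorWeightCirc_polarAngle (by norm_num) n₂ ω₂))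

/-- `|Z| ≤ 1` (all factors take values in `[0, 1]`). [folklore] -/
theorem abs_angularFactor_le_one (p : Fin 2 → ℝ) : |Z p| ≤ 1 := by
  rw [hZ]
  have hg : ∀ t : ℝ, 0 ≤ gnCutoff ((π + z) ^ 2 / π ^ 2) ((π + z) ^ 2) t ∧ gnCutoff ((π + z) ^ 2 / π ^ 2) ((π + z) ^ 2) t ≤ 1 :=
    fun t => ⟨(gnCutoff_mem_Icc _ _ t).1, (gnCutoff_mem_Icc _ _ t).2⟩
  have hR : 0 ≤ radialCutoffC (1 / 2) (momToComplex p) ∧ radialCutoffC (1 / 2) (momToComplex p) ≤ 1 :=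
    ⟨(radialCutoffC_mem_Icc _ _).1, (radialCutoffC_mem_Icc _ _).2⟩
  have hζ : ∀ (n : ℕ) (ω : ℤ), 0 ≤ sectorWeightCirc n ω (polarAngle p) ∧ sectorWeightCirc n ω (polarAngle p) ≤ 1 := fun n ω =>
    ⟨sectorWeightCirc_nonneg _ _ _, sectorWeightCirc_le_one _ _ _⟩
  have hA : ∀ (n : ℕ) (ω : ℤ), 0 ≤ radialCutoffC (1 / 2) (momToComplex p) * sectorWeightCirc n ω (polarAngle p) ∧
      radialCutoffC (1 / 2) (momToComplex p) * sectorWeightCirc n ω (polarAngle p) ≤ 1 := fun n ω =>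
    ⟨mul_nonneg hR.1 (hζ n ω).1, mul_le_one₀ hR.2 (hζ n ω).1 (hζ n ω).2⟩
  rw [abs_le]
  constructor
  · have : 0 ≤ gnCutoff ((π + z) ^ 2 / π ^ 2) ((π + z) ^ 2) (p 0 ^ 2) * gnCutoff ((π + z) ^ 2 / π ^ 2) ((π + z) ^ 2) (p 1 ^ 2) *
        ((radialCutoffC (1 / 2) (momToComplex p) * sectorWeightCirc n₁ ω₁ (polarAngle p)) *
          (radialCutoffC (1 / 2) (momToComplex p) * sectorWeightCirc n₂ ω₂ (polarAngle p))) :=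
      mul_nonneg (mul_nonneg (hg _).1 (hg _).1) (mul_nonneg (hA _ _).1 (hA _ _).1)
    linarith
  · exact mul_le_one₀ (mul_le_one₀ (hg _).2 (hg _).1 (hg _).2) (mul_nonneg (hA _ _).1 (hA _ _).1)
      (mul_le_one₀ (hA _ _).2 (hA _ _).1 (hA _ _).2)

/-- **Support**: `Z(p) ≠ 0 ⇒ ζ̃_{n₁,ω₁}(θ(p)) ≠ 0 ∧ ζ̃_{n₂,ω₂}(θ(p)) ≠ 0`. [folklore] -/
theorem angularFactor_support {p : Fin 2 → ℝ} (h : Z p ≠ 0) :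
    sectorWeightCirc n₁ ω₁ (polarAngle p) ≠ 0 ∧ sectorWeightCirc n₂ ω₂ (polarAngle p) ≠ 0 := by
  rw [hZ] at h
  obtain ⟨-, h2⟩ := mul_ne_zero_iff.1 h
  obtain ⟨hA, hB⟩ := mul_ne_zero_iff.1 h2
  exact ⟨(mul_ne_zero_iff.1 hA).2, (mul_ne_zero_iff.1 hB).2⟩

/-- **Zone**: `Z(p) = 0` as soon as `|p_j| ≥ π + z` for some `j` (`z > 0`). [folklore] -/
theorem angularFactor_zone (hz : 0 < z) {p : Fin 2 → ℝ} (h : ∃ j, π + z ≤ |p j|) : Z p = 0 := by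
  obtain ⟨j, hj⟩ := h
  have hπz : 0 ≤ π + z := by linarith [Real.pi_pos]
  have hsq : (π + z) ^ 2 ≤ p j ^ 2 := by
    rw [← sq_abs (p j)]; exact pow_le_pow_left₀ hπz hj 2
  rw [hZ]
  fin_cases j
  · rw [sqCutoff_eq_zero hz (by simpa using hsq)]; ring
  · rw [mul_comm (gnCutoff _ _ (p 0 ^ 2)), sqCutoff_eq_zero hz (by simpa using hsq)]; ring

/-- **Near a point of the open square in the Fermi region the cutoffs are invisible**: along any line, if `|(p₀ + s•w)_i| < π` for both
`i` and `‖p₀ + s•w‖ > ½`, then `σ ↦ Z(p₀ + σ•w)` agrees near `s` with the product of the two PLATEAUED angular factors. [folklore] -/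
theorem angularFactor_line_eventuallyEq (hz : 0 < z) (p₀ w : Fin 2 → ℝ) {s : ℝ} (hsq : ∀ i, |(p₀ + s • w) i| < π) :
    (fun σ : ℝ => Z (p₀ + σ • w)) =ᶠ[𝓝 s] fun σ =>
      (radialCutoffC (1 / 2) (momToComplex (p₀ + σ • w)) * sectorWeightCirc n₁ ω₁ (polarAngle (p₀ + σ • w))) *
        (radialCutoffC (1 / 2) (momToComplex (p₀ + σ • w)) * sectorWeightCirc n₂ ω₂ (polarAngle (p₀ + σ • w))) := by
  have hcont : ∀ i : Fin 2, Continuous fun σ : ℝ => (p₀ + σ • w) i := fun i => by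
    simp only [Pi.add_apply, Pi.smul_apply, smul_eq_mul]; fun_prop
  have hopen : ∀ i : Fin 2, ∀ᶠ σ in 𝓝 s, |(p₀ + σ • w) i| < π := fun i =>
    (continuous_abs.comp (hcont i)).continuousAt.eventually_lt continuousAt_const (hsq i)
  filter_upwards [hopen 0, hopen 1] with σ h0 h1
  rw [hZ]
  have e0 : gnCutoff ((π + z) ^ 2 / π ^ 2) ((π + z) ^ 2) ((p₀ + σ • w) 0 ^ 2) = 1 :=
    sqCutoff_eq_one hz (by rw [← sq_abs]; exact pow_le_pow_left₀ (abs_nonneg _) h0.le 2)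
  have e1 : gnCutoff ((π + z) ^ 2 / π ^ 2) ((π + z) ^ 2) ((p₀ + σ • w) 1 ^ 2) = 1 :=
    sqCutoff_eq_one hz (by rw [← sq_abs]; exact pow_le_pow_left₀ (abs_nonneg _) h1.le 2)
  rw [e0, e1, one_mul, one_mul]

end Angular

/-! ### §3 Line derivatives of one plateaued angular factor, then of the product -/

/-- The plateaued angular factor along a line is smooth. [folklore] -/
theorem contDiff_plateaued_line (n : ℕ) (ω : ℤ) (p₀ w : Fin 2 → ℝ) {m : ℕ∞} :
    ContDiff ℝ m fun σ : ℝ => radialCutoffC (1 / 2) (momToComplex (p₀ + σ • w)) * sectorWeightCirc n ω (polarAngle (p₀ + σ • w)) :=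
  (contDiff_radial_mul_sectorWeightCirc_polarAngle (by norm_num) n ω).comp (contDiff_const.add (contDiff_id.smul contDiff_const))

/-- The relative angle of a point with respect to its own polar angle is `0`. [folklore] -/
theorem sectorRelAngle_self (k : Fin 2 → ℝ) : sectorRelAngle (polarAngle k) k = 0 := by
  rw [sectorRelAngle, polarAngle]
  have h := Complex.norm_mul_exp_arg_mul_I (momToComplex k)
  have h1 : momToComplex k * Complex.exp (-((Complex.arg (momToComplex k) : ℂ) * Complex.I)) = ((‖momToComplex k‖ : ℝ) : ℂ) := by
    calc momToComplex k * Complex.exp (-((Complex.arg (momToComplex k) : ℂ) * Complex.I))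
        = (((‖momToComplex k‖ : ℝ) : ℂ) * Complex.exp ((Complex.arg (momToComplex k) : ℂ) * Complex.I)) *
            Complex.exp (-((Complex.arg (momToComplex k) : ℂ) * Complex.I)) := by rw [h]
      _ = _ := by rw [mul_assoc, ← Complex.exp_add, add_neg_cancel, Complex.exp_zero, mul_one]
  rw [h1, Complex.arg_ofReal_of_nonneg (norm_nonneg _)]

/-- **Derivatives of one plateaued angular factor along a line at a point of the Fermi region** (`‖p₀ + s•w‖ ≥ 1`): for `i ≤ 2`,
`|∂_σⁱ [R·ζ̃_{n,ω}∘θ](s)| ≤ 2B((1 + 2/w_n)‖w₁+iw₂‖)ⁱ`, `B` the constant of `exists_norm_iteratedDeriv_sectorWeightCirc_polarAngle_line_le 2`.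
[cite: BenfattoGiulianiMastropietro2006, §2.5 Lemma 2.2] -/
theorem abs_iteratedDeriv_plateaued_line_le {B : ℝ}
    (hB : ∀ (i : ℕ), i ≤ 2 → ∀ (n : ℕ) (ω : ℤ) (θ₀ : ℝ) (q w : Fin 2 → ℝ) (t : ℝ) {r₀ : ℝ}, 0 < r₀ →
      r₀ ≤ ‖momToComplex (q + t • w)‖ → |sectorRelAngle θ₀ (q + t • w)| < π →
      ‖iteratedDeriv i (fun t : ℝ => sectorWeightCirc n ω (polarAngle (q + t • w))) t‖ ≤
        (2 : ℕ)! * B * ((1 + (sectorWidth n)⁻¹ * (2 : ℕ)!) * ‖momToComplex w‖ / r₀) ^ i)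
    (n : ℕ) (ω : ℤ) (p₀ w : Fin 2 → ℝ) {s : ℝ} (hfermi : 1 ≤ ‖momToComplex (p₀ + s • w)‖) {i : ℕ} (hi : i ≤ 2) :
    |iteratedDeriv i (fun σ : ℝ => radialCutoffC (1 / 2) (momToComplex (p₀ + σ • w)) * sectorWeightCirc n ω (polarAngle (p₀ + σ • w))) s|
      ≤ 2 * B * ((1 + 2 * (sectorWidth n)⁻¹) * ‖momToComplex w‖) ^ i := by
  -- near `s` the plateau is `≡ 1`
  have hcont : Continuous fun σ : ℝ => ‖momToComplex (p₀ + σ • w)‖ :=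
    continuous_norm.comp (contDiff_momToComplex (m := 0) |>.continuous.comp (by fun_prop))
  have hhalf : (1 : ℝ) / 2 < ‖momToComplex (p₀ + s • w)‖ := by linarith
  have hopen : ∀ᶠ σ in 𝓝 s, (1 : ℝ) / 2 < ‖momToComplex (p₀ + σ • w)‖ :=
    hcont.continuousAt.eventually_mem (Ioi_mem_nhds hhalf)
  have hev : (fun σ : ℝ => radialCutoffC (1 / 2) (momToComplex (p₀ + σ • w)) * sectorWeightCirc n ω (polarAngle (p₀ + σ • w))) =ᶠ[𝓝 s]
      fun σ => sectorWeightCirc n ω (polarAngle (p₀ + σ • w)) := by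
    filter_upwards [hopen] with σ hσ
    rw [radialCutoffC_eq_one (by norm_num) hσ.le, one_mul]
  rw [hev.iteratedDeriv_eq]
  have h := hB i hi n ω (polarAngle (p₀ + s • w)) p₀ w s one_pos hfermi (by rw [sectorRelAngle_self, abs_zero]; exact Real.pi_pos)
  rw [Real.norm_eq_abs] at h
  refine h.trans (le_of_eq ?_)
  simp only [Nat.factorial_two, Nat.cast_ofNat, div_one]
  ring

/-- **Line derivatives of the angular factor on the Fermi region of the open square**: with `Dᵢ = (1 + 2/w_{nᵢ})‖w₁ + iw₂‖`,
at a point with `|(p₀+s•w)_i| < π` and `‖p₀ + s•w‖ ≥ 1`: `|∂ₛ Z| ≤ 2B(D₁ + D₂)` and `|∂ₛ² Z| ≤ 2B(D₁² + D₂²) + 8B²D₁D₂`.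
[cite: BenfattoGiulianiMastropietro2006, §2.5 Lemma 2.2, §2.7 (2.71a)] -/
theorem abs_derivs_angularFactor_line_le {z : ℝ} (hz : 0 < z) {n₁ n₂ : ℕ} {ω₁ ω₂ : ℤ} {Z : (Fin 2 → ℝ) → ℝ}
    (hZ : ∀ p, Z p = gnCutoff ((π + z) ^ 2 / π ^ 2) ((π + z) ^ 2) (p 0 ^ 2) * gnCutoff ((π + z) ^ 2 / π ^ 2) ((π + z) ^ 2) (p 1 ^ 2) *
      ((radialCutoffC (1 / 2) (momToComplex p) * sectorWeightCirc n₁ ω₁ (polarAngle p)) *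
        (radialCutoffC (1 / 2) (momToComplex p) * sectorWeightCirc n₂ ω₂ (polarAngle p))))
    {B : ℝ} (hB0 : 0 ≤ B)
    (hB : ∀ (i : ℕ), i ≤ 2 → ∀ (n : ℕ) (ω : ℤ) (θ₀ : ℝ) (q w : Fin 2 → ℝ) (t : ℝ) {r₀ : ℝ}, 0 < r₀ →
      r₀ ≤ ‖momToComplex (q + t • w)‖ → |sectorRelAngle θ₀ (q + t • w)| < π →
      ‖iteratedDeriv i (fun t : ℝ => sectorWeightCirc n ω (polarAngle (q + t • w))) t‖ ≤
        (2 : ℕ)! * B * ((1 + (sectorWidth n)⁻¹ * (2 : ℕ)!) * ‖momToComplex w‖ / r₀) ^ i)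
    (p₀ w : Fin 2 → ℝ) {s : ℝ} (hsq : ∀ i, |(p₀ + s • w) i| < π) (hfermi : 1 ≤ ‖momToComplex (p₀ + s • w)‖) :
    |deriv (fun σ : ℝ => Z (p₀ + σ • w)) s| ≤
        2 * B * (((1 + 2 * (sectorWidth n₁)⁻¹) * ‖momToComplex w‖) + ((1 + 2 * (sectorWidth n₂)⁻¹) * ‖momToComplex w‖)) ∧
      |iteratedDeriv 2 (fun σ : ℝ => Z (p₀ + σ • w)) s| ≤
        2 * B * (((1 + 2 * (sectorWidth n₁)⁻¹) * ‖momToComplex w‖) ^ 2 + ((1 + 2 * (sectorWidth n₂)⁻¹) * ‖momToComplex w‖) ^ 2) +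
          8 * B ^ 2 * (((1 + 2 * (sectorWidth n₁)⁻¹) * ‖momToComplex w‖) * ((1 + 2 * (sectorWidth n₂)⁻¹) * ‖momToComplex w‖)) := by
  set g₁ : ℝ → ℝ := fun σ => radialCutoffC (1 / 2) (momToComplex (p₀ + σ • w)) * sectorWeightCirc n₁ ω₁ (polarAngle (p₀ + σ • w))
    with hg₁
  set g₂ : ℝ → ℝ := fun σ => radialCutoffC (1 / 2) (momToComplex (p₀ + σ • w)) * sectorWeightCirc n₂ ω₂ (polarAngle (p₀ + σ • w))
    with hg₂
  set D₁ : ℝ := (1 + 2 * (sectorWidth n₁)⁻¹) * ‖momToComplex w‖ with hD₁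
  set D₂ : ℝ := (1 + 2 * (sectorWidth n₂)⁻¹) * ‖momToComplex w‖ with hD₂
  have hev := angularFactor_line_eventuallyEq hZ hz p₀ w hsq
  have hc₁ : ContDiff ℝ 2 g₁ := contDiff_plateaued_line n₁ ω₁ p₀ w
  have hc₂ : ContDiff ℝ 2 g₂ := contDiff_plateaued_line n₂ ω₂ p₀ w
  -- sizes of the factors and their derivatives at `s`
  have hb : ∀ (n : ℕ) (ω : ℤ) (σ : ℝ), |radialCutoffC (1 / 2) (momToComplex (p₀ + σ • w)) * sectorWeightCirc n ω (polarAngle (p₀ + σ • w))| ≤ 1 := by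
    intro n ω σ
    rw [abs_mul, abs_of_nonneg (radialCutoffC_mem_Icc _ _).1, abs_of_nonneg (sectorWeightCirc_nonneg _ _ _)]
    exact mul_le_one₀ (radialCutoffC_mem_Icc _ _).2 (sectorWeightCirc_nonneg _ _ _) (sectorWeightCirc_le_one _ _ _)
  have h10 : |g₁ s| ≤ 1 := hb n₁ ω₁ s
  have h20 : |g₂ s| ≤ 1 := hb n₂ ω₂ s
  have h11 : |deriv g₁ s| ≤ 2 * B * D₁ := by
    have h := abs_iteratedDeriv_plateaued_line_le hB n₁ ω₁ p₀ w hfermi (i := 1) (by norm_num)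
    rw [iteratedDeriv_one, pow_one] at h; exact h
  have h21 : |deriv g₂ s| ≤ 2 * B * D₂ := by
    have h := abs_iteratedDeriv_plateaued_line_le hB n₂ ω₂ p₀ w hfermi (i := 1) (by norm_num)
    rw [iteratedDeriv_one, pow_one] at h; exact h
  have h12 : |iteratedDeriv 2 g₁ s| ≤ 2 * B * D₁ ^ 2 := abs_iteratedDeriv_plateaued_line_le hB n₁ ω₁ p₀ w hfermi (i := 2) le_rfl
  have h22 : |iteratedDeriv 2 g₂ s| ≤ 2 * B * D₂ ^ 2 := abs_iteratedDeriv_plateaued_line_le hB n₂ ω₂ p₀ w hfermi (i := 2) le_rfl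
  have hD₁0 : 0 ≤ D₁ := by have := sectorWidth_pos n₁; positivity
  have hD₂0 : 0 ≤ D₂ := by have := sectorWidth_pos n₂; positivity
  constructor
  · rw [hev.deriv_eq, deriv_mul₂ hc₁ hc₂ s]
    calc _ ≤ |deriv g₁ s * g₂ s| + |g₁ s * deriv g₂ s| := abs_add_le _ _
      _ = |deriv g₁ s| * |g₂ s| + |g₁ s| * |deriv g₂ s| := by
          rw [abs_mul (deriv g₁ s) (g₂ s), abs_mul (g₁ s) (deriv g₂ s)]
      _ ≤ 2 * B * D₁ * 1 + 1 * (2 * B * D₂) :=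
          add_le_add (mul_le_mul h11 h20 (abs_nonneg _) (by positivity)) (mul_le_mul h10 h21 (abs_nonneg _) zero_le_one)
      _ = 2 * B * (D₁ + D₂) := by ring
  · rw [hev.iteratedDeriv_eq, iteratedDeriv_two_mul₂ hc₁ hc₂ s]
    calc _ ≤ |iteratedDeriv 2 g₁ s * g₂ s + 2 * (deriv g₁ s * deriv g₂ s)| + |g₁ s * iteratedDeriv 2 g₂ s| := abs_add_le _ _
      _ ≤ |iteratedDeriv 2 g₁ s * g₂ s| + |2 * (deriv g₁ s * deriv g₂ s)| + |g₁ s * iteratedDeriv 2 g₂ s| := by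
          gcongr; exact abs_add_le _ _
      _ = |iteratedDeriv 2 g₁ s| * |g₂ s| + 2 * (|deriv g₁ s| * |deriv g₂ s|) + |g₁ s| * |iteratedDeriv 2 g₂ s| := by
          rw [abs_mul (iteratedDeriv 2 g₁ s) (g₂ s), abs_mul (2 : ℝ) _, abs_mul (deriv g₁ s) (deriv g₂ s),
            abs_mul (g₁ s) (iteratedDeriv 2 g₂ s), abs_two]
      _ ≤ 2 * B * D₁ ^ 2 * 1 + 2 * ((2 * B * D₁) * (2 * B * D₂)) + 1 * (2 * B * D₂ ^ 2) := by
          refine add_le_add (add_le_add ?_ ?_) ?_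
          · exact mul_le_mul h12 h20 (abs_nonneg _) (by positivity)
          · exact mul_le_mul_of_nonneg_left (mul_le_mul h11 h21 (abs_nonneg _) (by positivity)) (by norm_num)
          · exact mul_le_mul h10 h22 (abs_nonneg _) zero_le_one
      _ = 2 * B * (D₁ ^ 2 + D₂ ^ 2) + 8 * B ^ 2 * (D₁ * D₂) := by ring

end Summit.HubbardSuperconductivity.HubbardSuperconductivity.Theorems.TorusFourierL2

end
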